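import Summits.CriticalPhenomena.PercolationContinuityZ3.Theorems.PercNearOneGluingAdditiveGluingCovTransferCertCheck
import Summits.CriticalPhenomena.PercolationContinuityZ3.Theorems.PercNearOneGluingNoHeavyLowerTailOneCutCertAssembly

/-!
# `AdditiveGluing` (crux stmt-CriticalPhenomena-4576), kernel (T) = `stub_k0CovTransferQ_c9`: the covariance transfer
# holds on every weighted graph with at most five vertices (kernel-checked three-copy certificate)

Support file (certificate seat `prim-cert-2`; `--supports stmt-CriticalPhenomena-4576`; COMPUTATIONAL: the evaluations of the
checker `checkT` of `…CovTransferCertCheck` use `native_decide`).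

**Theorem `covTransferQ_of_le_five`.**  For every `n ≤ 5`, every weight vector `w : Sym2 (Fin n) → [0,1]` and ALL role
tuples `o b u v c : Fin n` (coincidences allowed), the registered covariance-transfer inequality (T) holds:

  `μ(uvᶜ)·(μ(uvᶜ ∩ ub ∩ vo)·μ(cuᶜ ∩ cvᶜ) − μ(uvᶜ ∩ ub ∩ vc)·μ(cuᶜ ∩ cvᶜ ∩ oc))
     ≤ μ(uvᶜ ∩ ub)·(μ(uvᶜ ∩ vo)·μ(cuᶜ ∩ cvᶜ) − μ(uvᶜ ∩ vc)·μ(cuᶜ ∩ cvᶜ ∩ oc))`,   `μ = prodBernoulli w`, `xy = {x ↔ y}`.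

This is the `n ≤ 5` slice of `stub_k0CovTransferQ_c9` (equivalently of lead c12's counting kernel (CNT) =
`stub_fibreSumT_nonneg_c12`, via `…AdditiveGluingFibreCriterion`): on `K₅` with symbolic weights every one of the `4^10` three-copy
fibre sums of `RHS − LHS` is a nonnegative integer, for each of the 52 role patterns; smaller `n` are checked over all role tuples.
Proof: `checkList` evaluations (`native_decide`) + `covTransferQ_of_checkT` + transport along vertex relabellings
(`tIneq_relabel`, using `relabelW` / `preimage_relabel_openConn` of `…OneCutCertAssembly`) from the 52 canonical patterns to all
`5^5` tuples (`cover_five`).  Independent exact censuses of the same fibre sums: LeadMath-c12 (crux directory), prim-cert-2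
FINDING-T-FIBREWISE (K5, K6 complete, n ≤ 8 samples; kit j061488, j061535).
-/

namespace Summit.CriticalPhenomena.PercolationContinuityZ3.Theorems.CovTransferCert

open Finset MeasureTheory OneCutCert
open scoped BigOperators
open Literature.Probability.Percolation Literature.Probability.LatticeModels

variable {n : ℕ}

/-! ## The inequality as a predicate and its transport along relabellings -/

/-- The covariance-transfer inequality (T) at `(n, w, o, b, u, v, c)` (the body of `stub_k0CovTransferQ_c9`). [this work] -/
def TIneq (w : Sym2 (Fin n) → unitInterval) (o b u v c : Fin n) : Prop :=
  (prodBernoulli w).real ((openConn u v)ᶜ : Set (BondConfig (Fin n))) *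
      ((prodBernoulli w).real ((openConn u v)ᶜ ∩ openConn u b ∩ openConn v o : Set (BondConfig (Fin n))) *
          (prodBernoulli w).real ((openConn c u)ᶜ ∩ (openConn c v)ᶜ : Set (BondConfig (Fin n))) -
        (prodBernoulli w).real ((openConn u v)ᶜ ∩ openConn u b ∩ openConn v c : Set (BondConfig (Fin n))) *
          (prodBernoulli w).real ((openConn c u)ᶜ ∩ (openConn c v)ᶜ ∩ openConn o c : Set (BondConfig (Fin n)))) ≤
    (prodBernoulli w).real ((openConn u v)ᶜ ∩ openConn u b : Set (BondConfig (Fin n))) *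
      ((prodBernoulli w).real ((openConn u v)ᶜ ∩ openConn v o : Set (BondConfig (Fin n))) *
          (prodBernoulli w).real ((openConn c u)ᶜ ∩ (openConn c v)ᶜ : Set (BondConfig (Fin n))) -
        (prodBernoulli w).real ((openConn u v)ᶜ ∩ openConn v c : Set (BondConfig (Fin n))) *
          (prodBernoulli w).real ((openConn c u)ᶜ ∩ (openConn c v)ᶜ ∩ openConn o c : Set (BondConfig (Fin n))))

/-- A passing check gives (T) at every weight vector. [this work] -/
theorem tIneq_of_checkT {o b u v c : Fin n} {σ : ℕ} (h : checkT n o b u v c σ = true)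
    (w : Sym2 (Fin n) → unitInterval) : TIneq w o b u v c :=
  covTransferQ_of_checkT o b u v c σ h w

/-- (T) is transported along a relabelling of the vertices. [this work] -/
theorem tIneq_relabel (σ : Fin n ≃ Fin n) (w : Sym2 (Fin n) → unitInterval) (o b u v c : Fin n)
    (h : TIneq w o b u v c) : TIneq (relabelW σ w) (σ o) (σ b) (σ u) (σ v) (σ c) := by
  unfold TIneq at h ⊢
  simp only [← prodBernoulli_real_preimage_relabel (sym2Equiv σ) w (relabelW σ w) (relabelW_apply σ w),
    Set.preimage_inter, Set.preimage_compl, preimage_relabel_openConn]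
  exact h

/-- (T) for all weights at a role tuple gives (T) for all weights at every relabelled tuple. [this work] -/
theorem tIneq_forall_relabel (σ : Fin n ≃ Fin n) {o b u v c : Fin n}
    (h : ∀ w : Sym2 (Fin n) → unitInterval, TIneq w o b u v c) (w : Sym2 (Fin n) → unitInterval) :
    TIneq w (σ o) (σ b) (σ u) (σ v) (σ c) := by
  have hw : relabelW σ (fun e => w (sym2Equiv σ e)) = w := by
    funext e
    unfold relabelW
    simp only [Equiv.apply_symm_apply]
  rw [← hw]
  exact tIneq_relabel σ _ o b u v c (h _)

/-! ## All role tuples, canonical patterns -/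

/-- All role tuples of `Fin n`. [this work] -/
def allTuples (n : ℕ) : List (Fin n × Fin n × Fin n × Fin n × Fin n) :=
  (List.finRange n).flatMap fun o => (List.finRange n).flatMap fun b => (List.finRange n).flatMap fun u =>
    (List.finRange n).flatMap fun v => (List.finRange n).map fun c => (o, b, u, v, c)

/-- Every tuple is listed. [this work] -/
theorem mem_allTuples (o b u v c : Fin n) : (o, b, u, v, c) ∈ allTuples n := by
  simp [allTuples, List.mem_flatMap, List.mem_map]

/-- The 52 canonical role patterns of `Fin 5` (restricted-growth tuples: roles labelled in order of first occurrence).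
[this work] -/
def canonFive : List (Fin 5 × Fin 5 × Fin 5 × Fin 5 × Fin 5) :=
  [(0, 0, 0, 0, 0), (0, 0, 0, 0, 1), (0, 0, 0, 1, 0), (0, 0, 0, 1, 1), (0, 0, 0, 1, 2), (0, 0, 1, 0, 0),
    (0, 0, 1, 0, 1), (0, 0, 1, 0, 2), (0, 0, 1, 1, 0), (0, 0, 1, 1, 1), (0, 0, 1, 1, 2), (0, 0, 1, 2, 0),
    (0, 0, 1, 2, 1), (0, 0, 1, 2, 2), (0, 0, 1, 2, 3), (0, 1, 0, 0, 0), (0, 1, 0, 0, 1), (0, 1, 0, 0, 2),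
    (0, 1, 0, 1, 0), (0, 1, 0, 1, 1), (0, 1, 0, 1, 2), (0, 1, 0, 2, 0), (0, 1, 0, 2, 1), (0, 1, 0, 2, 2),
    (0, 1, 0, 2, 3), (0, 1, 1, 0, 0), (0, 1, 1, 0, 1), (0, 1, 1, 0, 2), (0, 1, 1, 1, 0), (0, 1, 1, 1, 1),
    (0, 1, 1, 1, 2), (0, 1, 1, 2, 0), (0, 1, 1, 2, 1), (0, 1, 1, 2, 2), (0, 1, 1, 2, 3), (0, 1, 2, 0, 0),
    (0, 1, 2, 0, 1), (0, 1, 2, 0, 2), (0, 1, 2, 0, 3), (0, 1, 2, 1, 0), (0, 1, 2, 1, 1), (0, 1, 2, 1, 2),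
    (0, 1, 2, 1, 3), (0, 1, 2, 2, 0), (0, 1, 2, 2, 1), (0, 1, 2, 2, 2), (0, 1, 2, 2, 3), (0, 1, 2, 3, 0),
    (0, 1, 2, 3, 1), (0, 1, 2, 3, 2), (0, 1, 2, 3, 3), (0, 1, 2, 3, 4)]

/-- Every role tuple of `Fin 5` is a relabelled canonical pattern (finite check). [this work] -/
theorem cover_five : ∀ o b u v c : Fin 5, ∃ t ∈ canonFive, ∃ σ : Equiv.Perm (Fin 5),
    (σ t.1, σ t.2.1, σ t.2.2.1, σ t.2.2.2.1, σ t.2.2.2.2) = (o, b, u, v, c) := by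
  native_decide

/-! ## The evaluations -/

/-- `K₅`: the check passes for the 52 canonical role patterns (base `2^34`). [this work] -/
theorem checkList_five : checkList 5 34 canonFive = true := by
  native_decide

/-- `Fin 4`: the check passes for all `4^5` role tuples (base `2^22`). [this work] -/
theorem checkList_four : checkList 4 22 (allTuples 4) = true := by
  native_decide

/-- `Fin 3`: the check passes for all role tuples (base `2^13`). [this work] -/
theorem checkList_three : checkList 3 13 (allTuples 3) = true := by
  native_decide

/-- `Fin 2`: the check passes for all role tuples (base `2^7`). [this work] -/
theorem checkList_two : checkList 2 7 (allTuples 2) = true := by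
  native_decide

/-- `Fin 1`: the check passes for the unique role tuple (base `2^4`). [this work] -/
theorem checkList_one : checkList 1 4 (allTuples 1) = true := by
  native_decide

/-- (T) on `Fin 5` for all weights and all role tuples. [this work] -/
theorem tIneq_five (w : Sym2 (Fin 5) → unitInterval) (o b u v c : Fin 5) : TIneq w o b u v c := by
  obtain ⟨t, ht, σ, hσ⟩ := cover_five o b u v c
  obtain ⟨o₀, b₀, u₀, v₀, c₀⟩ := t
  simp only [Prod.mk.injEq] at hσ
  obtain ⟨rfl, rfl, rfl, rfl, rfl⟩ := hσ
  exact tIneq_forall_relabel σ (fun w' => tIneq_of_checkT (checkT_of_checkList checkList_five ht) w') w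

/-- (T) on `Fin n`, `n ≤ 4`, for all weights and all role tuples. [this work] -/
theorem tIneq_le_four : ∀ n ≤ 4, ∀ (w : Sym2 (Fin n) → unitInterval) (o b u v c : Fin n), TIneq w o b u v c := by
  intro n hn w o b u v c
  interval_cases n
  · exact o.elim0
  · exact tIneq_of_checkT (checkT_of_checkList checkList_one (mem_allTuples o b u v c)) w
  · exact tIneq_of_checkT (checkT_of_checkList checkList_two (mem_allTuples o b u v c)) w
  · exact tIneq_of_checkT (checkT_of_checkList checkList_three (mem_allTuples o b u v c)) w
  · exact tIneq_of_checkT (checkT_of_checkList checkList_four (mem_allTuples o b u v c)) w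

/-! ## The theorem -/

/-- **The covariance transfer (T) = `stub_k0CovTransferQ_c9` on every weighted graph with at most five vertices**, for all role
tuples: the `n ≤ 5` slice of the registered kernel of crux 4576 (all weights; coincident roles allowed), by the kernel-checked
three-copy certificate (all `4^m` tensor-Bernstein fibre sums of `RHS − LHS` are nonnegative — lead c12's (CNT) on `K₅`).
[this work] -/
theorem covTransferQ_of_le_five : ∀ (n : ℕ), n ≤ 5 → ∀ (w : Sym2 (Fin n) → unitInterval) (o b u v c : Fin n),
    (prodBernoulli w).real ((openConn u v)ᶜ : Set (BondConfig (Fin n))) *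
        ((prodBernoulli w).real ((openConn u v)ᶜ ∩ openConn u b ∩ openConn v o : Set (BondConfig (Fin n))) *
            (prodBernoulli w).real ((openConn c u)ᶜ ∩ (openConn c v)ᶜ : Set (BondConfig (Fin n))) -
          (prodBernoulli w).real ((openConn u v)ᶜ ∩ openConn u b ∩ openConn v c : Set (BondConfig (Fin n))) *
            (prodBernoulli w).real ((openConn c u)ᶜ ∩ (openConn c v)ᶜ ∩ openConn o c : Set (BondConfig (Fin n)))) ≤
      (prodBernoulli w).real ((openConn u v)ᶜ ∩ openConn u b : Set (BondConfig (Fin n))) *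
        ((prodBernoulli w).real ((openConn u v)ᶜ ∩ openConn v o : Set (BondConfig (Fin n))) *
            (prodBernoulli w).real ((openConn c u)ᶜ ∩ (openConn c v)ᶜ : Set (BondConfig (Fin n))) -
          (prodBernoulli w).real ((openConn u v)ᶜ ∩ openConn v c : Set (BondConfig (Fin n))) *
            (prodBernoulli w).real ((openConn c u)ᶜ ∩ (openConn c v)ᶜ ∩ openConn o c : Set (BondConfig (Fin n)))) := by
  intro n hn w o b u v c
  rcases Nat.lt_or_eq_of_le hn with h | rfl
  · exact tIneq_le_four n (by omega) w o b u v c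
  · exact tIneq_five w o b u v c

end Summit.CriticalPhenomena.PercolationContinuityZ3.Theorems.CovTransferCert
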